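import Mathlib
import HarnessLib
import HarnessLib.Audit.Tags

/-!
# CELL V7, ENGINE B-V7 (pub-hlocus abs-2 gen 4): exact layer of the ι / σ bookkeeping at the Hilbert points of the `(1/2)⁴` pencil

HONEST FRAMING: certified instances and evidence bearing on the general Hodge conjecture; no claim.

Companion to `HodgeLocusCensusAttractorDescentAnchors.lean` (engine A, abs-1 gen 6).  CELL V7 (ABSHODGE.md `#### V7`)
attaches to a rank-2 attractor point `z*` of a fourth-order Calabi–Yau operator two invariants `(α, β) ∈ ℂ²`, the
coefficients of the cubic `D³ + β D² + α D` in `Θ = z d/dz` which, applied to the normalised period vector, is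
annihilated by the rank-2 relation module; dR-descent predicts `(α, β) ∈ K = ℚ(z*)` and Galois-equivariance in `z*`.

For the hypergeometric operator `L = θ⁴ − 2⁸ z (θ + ½)⁴` the substitution `z ↦ w = 1/(2¹⁶ z)` together with the
half-twist `y = z^{-1/2} ỹ(w)` carries `L` to `−2⁻⁸ · z^{-1/2} · L_w` — as a polynomial identity in `(θ_w, w)` this is
`h2222_iota_operator` (with `θ_z = −½ − θ_w` on the twisted function, the `θ_z`-symbol `θ⁴ − 2⁸ z (θ+½)⁴` becomes
`(θ_w + ½)⁴ − 2⁻⁸ w⁻¹ θ_w⁴`, and multiplying by `2¹⁶ w` gives the left side).  Hence solutions go to solutions, the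
normalised period vector at `z` is a constant multiple of a `K`-rational recombination of the one at `w`, and the cubic
transforms by `D ↦ −½ − D` (`iota_cubic`): the constant term is absorbed by the relation module itself (its vectors
already annihilate the period vector), so the invariants in the `w`-frame are `ι(α, β) := (α − β + ¾, 3/2 − β)`
(`iota`, an involution: `iota_involutive`; it forces `β + β' = 3/2`: `iota_trace`).

The two Hilbert points `z∓ = (17 ∓ 12√2)/2⁸` are swapped by `ι` (`hilbert_points_iota_swap`, from engine A's
`hilbert_pair` identity `(17 − 12 r)(17 + 12 r) = 1`) AND by `σ : √2 ↦ −√2`.  Engine A and engine B both find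
`(α, β)(z₋) = (5/16 − (7/32)√2, 3/4 − (7/16)√2)`; `iota_hilbert` checks that `ι` of this pair equals its Galois conjugate,
so the symmetry prediction and the descent (σ-equivariance) prediction for `z₊` COINCIDE — the exact content of engine
B's `IOTA-PASS` record (data/abs/engineB/v7, bookkeeping_*.json) — and both equal the value both engines compute at `z₊`
by analytic continuation.  Nothing here is numerical; the numerics live in HOME/data/abs/v7 (A) and HOME/data/abs/engineB/v7 (B).
-/

namespace Summit.HodgeConjecture.HodgeConjecture.HodgeLocus.Census

/-- Operator dictionary for `θ⁴ − 2⁸ z (θ+½)⁴` under `z ↦ 1/(2¹⁶ z)` with the half-twist: after the substitution the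
`θ_w`-symbol times `2¹⁶ w` is `−2⁸` times the original symbol read in `w`. -/
theorem h2222_iota_operator (θ w : ℚ) :
    (2:ℚ) ^ 16 * w * (θ + 1/2) ^ 4 - 2 ^ 8 * θ ^ 4 = -(2:ℚ) ^ 8 * (θ ^ 4 - 2 ^ 8 * w * (θ + 1/2) ^ 4) := by
  ring

/-- The cubic `D³ + b D² + a D` under `D ↦ −½ − D`: up to sign and a constant term it is the cubic with
coefficients `(a − b + ¾, 3/2 − b)`. -/
theorem iota_cubic {K : Type*} [Field K] [CharZero K] (D a b : K) :
    (-1/2 - D) ^ 3 + b * (-1/2 - D) ^ 2 + a * (-1/2 - D)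
      = -(D ^ 3 + (3/2 - b) * D ^ 2 + (a - b + 3/4) * D) + (-1/8 + b/4 - a/2) := by
  ring

/-- The induced map on the invariants `(α, β)`. -/
def iota {K : Type*} [Field K] (p : K × K) : K × K := (p.1 - p.2 + 3/4, 3/2 - p.2)

/-- `ι` is an involution on `K × K`. -/
theorem iota_involutive {K : Type*} [Field K] [CharZero K] (p : K × K) : iota (iota p) = p := by
  obtain ⟨a, b⟩ := p
  simp only [iota, Prod.mk.injEq]
  constructor <;> ring

/-- `ι` forces the trace identity `β + β' = 3/2` on an `ι`-pair. -/
theorem iota_trace {K : Type*} [Field K] (p : K × K) : p.2 + (iota p).2 = 3/2 := by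
  simp only [iota]; ring

/-- At the Hilbert points: `ι(5/16 − (7/32) r, 3/4 − (7/16) r) = (5/16 + (7/32) r, 3/4 + (7/16) r)` for every `r`
(in particular `r = √2`): the `ι`-image of the invariants at `z₋` is their `σ`-conjugate. -/
theorem iota_hilbert {K : Type*} [Field K] [CharZero K] (r : K) :
    iota ((5/16 - 7/32 * r, 3/4 - 7/16 * r) : K × K) = (5/16 + 7/32 * r, 3/4 + 7/16 * r) := by
  simp only [iota, Prod.mk.injEq]
  constructor <;> ring

/-- `ι : z ↦ 1/(2¹⁶ z)` swaps the Hilbert points: `z₋ · z₊ = 2⁻¹⁶` (a restatement of engine A's `hilbert_pair`). -/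
theorem hilbert_points_iota_swap {K : Type*} [Field K] [CharZero K] (r : K) (hr : r ^ 2 = 2) :
    ((17 - 12 * r) / 2 ^ 8) * ((17 + 12 * r) / 2 ^ 8) = 1 / 2 ^ 16 := by
  have h : (17 - 12 * r) * (17 + 12 * r) = 289 - 144 * r ^ 2 := by ring
  rw [div_mul_div_comm, h, hr]; norm_num

end Summit.HodgeConjecture.HodgeConjecture.HodgeLocus.Census
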